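import Mathlib
import Summits.Parity.GeneralizedHardyLittlewood.Theorems.ParityLeakOneFifthPlainSplitTwistedModel
import Summits.Parity.GeneralizedHardyLittlewood.Theorems.ParityLeakOneFifthPlainSplitTwistedRemainderSum
import Summits.Parity.GeneralizedHardyLittlewood.Theorems.ParityLeakOneFifthParityLeakSieveHostTypeI
import HarnessLib

/-!
# Route ParityLeakOneFifth, crux `ParityLeakSieve` (stmt-Parity-18381), skeleton `birth`:
# the Type-I comparison of stub S1 — the decomposition over the moduli `d`

With `Θ_w(m) = 1[w ≤ P⁻(m)]·G(m)`, `G(m) = Σ_{d ∣ m, d ≤ D, d y-rough} μ(d)`, host `a(n) = log n·1[n prime]`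
and model `b(n) = 1[n z-rough]/V`:
`Σ_n (a(n) − b(n)) Θ_w(n+2) = Σ_{d ≤ D, y-rough} μ(d)·(S_a(d) − N_b(d)/V)` (`typeI_decomp`), where
`S_a(d) = Σ_{n prime, d ∣ n+2, w ≤ P⁻(n+2)} log n` and `N_b(d) = #{n z-rough : w ≤ P⁻(n+2), d ∣ n+2}`;
hence `|Σ (a − b)Θ_w| ≤ Σ_d |S_a(d) − N_b(d)/V|` (`abs_typeI_le`).  Also: the remainders of the host in
the progressions `de` are bounded one by one by the prime number theorem in progressions
(`host_rem_pair_le`) and re-indexed injectively by `q = de ≤ Q` (`sum_pairs_le_sum_Icc`).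
-/

namespace Summit.Parity.GeneralizedHardyLittlewood.Theorems.ParityLeakOneFifth

open Finset Real
open scoped ArithmeticFunction.Moebius ArithmeticFunction.vonMangoldt Chebyshev
open Literature.NumberTheory.Sieve

/-- **Decomposition of the Type-I difference over the moduli `d`.** -/
theorem typeI_decomp (x : ℕ) (z V w D y : ℝ) :
    ∑ n ∈ Finset.Ioc x (2 * x), ((if n.Prime then Real.log (n : ℝ) else 0) -
        (if ∀ p ∈ n.primeFactors, z ≤ (p : ℝ) then 1 / V else 0)) *
        (if w ≤ ((n + 2).minFac : ℝ) then
          ∑ d ∈ (Nat.divisors (n + 2)).filter (fun d : ℕ => (d : ℝ) ≤ D ∧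
            ∀ p ∈ d.primeFactors, y ≤ (p : ℝ)), (μ d : ℝ) else 0) =
      ∑ d ∈ (Finset.Icc 1 ⌊D⌋₊).filter (fun d : ℕ => (d : ℝ) ≤ D ∧ ∀ p ∈ d.primeFactors, y ≤ (p : ℝ)),
        (μ d : ℝ) * ((∑ n ∈ (Finset.Ioc x (2 * x)).filter (fun n : ℕ => n.Prime ∧ d ∣ n + 2 ∧
            w ≤ ((n + 2).minFac : ℝ)), Real.log (n : ℝ)) -
          (1 / V) * (#((Finset.Ioc x (2 * x)).filter (fun n : ℕ => (∀ p ∈ n.primeFactors, z ≤ (p : ℝ)) ∧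
            w ≤ ((n + 2).minFac : ℝ) ∧ d ∣ n + 2)) : ℝ)) := by
  set P : ℕ → Prop := fun d => (d : ℝ) ≤ D ∧ ∀ p ∈ d.primeFactors, y ≤ (p : ℝ) with hP
  have hPD : ∀ d, P d → d ≤ ⌊D⌋₊ := fun d hd => Nat.le_floor hd.1
  -- the host and model weights against `Θ_w`
  set fa : ℕ → ℝ := fun n => if n.Prime ∧ w ≤ ((n + 2).minFac : ℝ) then Real.log (n : ℝ) else 0 with hfa
  set fb : ℕ → ℝ := fun n => if (∀ p ∈ n.primeFactors, z ≤ (p : ℝ)) ∧ w ≤ ((n + 2).minFac : ℝ) then (1 : ℝ)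
    else 0 with hfb
  have hterm : ∀ n : ℕ, ((if n.Prime then Real.log (n : ℝ) else 0) -
      (if ∀ p ∈ n.primeFactors, z ≤ (p : ℝ) then 1 / V else 0)) *
      (if w ≤ ((n + 2).minFac : ℝ) then ∑ d ∈ (Nat.divisors (n + 2)).filter P, (μ d : ℝ) else 0) =
      fa n * ∑ d ∈ (Nat.divisors (n + 2)).filter P, (μ d : ℝ) -
        (1 / V) * (fb n * ∑ d ∈ (Nat.divisors (n + 2)).filter P, (μ d : ℝ)) := by
    intro n
    by_cases hw : w ≤ ((n + 2).minFac : ℝ)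
    · rw [if_pos hw]
      by_cases hp : n.Prime
      · rw [if_pos hp, show fa n = Real.log (n : ℝ) from if_pos ⟨hp, hw⟩]
        by_cases hr : ∀ p ∈ n.primeFactors, z ≤ (p : ℝ)
        · rw [if_pos hr, show fb n = 1 from if_pos ⟨hr, hw⟩]; ring
        · rw [if_neg hr, show fb n = 0 from if_neg (fun h => hr h.1)]; ring
      · rw [if_neg hp, show fa n = 0 from if_neg (fun h => hp h.1)]
        by_cases hr : ∀ p ∈ n.primeFactors, z ≤ (p : ℝ)
        · rw [if_pos hr, show fb n = 1 from if_pos ⟨hr, hw⟩]; ring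
        · rw [if_neg hr, show fb n = 0 from if_neg (fun h => hr h.1)]; ring
    · rw [if_neg hw, show fa n = 0 from if_neg (fun h => hw h.2), show fb n = 0 from if_neg (fun h => hw h.2)]
      ring
  rw [Finset.sum_congr rfl fun n _ => hterm n, Finset.sum_sub_distrib, ← Finset.mul_sum,
    sum_mul_sum_divisors_comm _ fa _ P ⌊D⌋₊ hPD, sum_mul_sum_divisors_comm _ fb _ P ⌊D⌋₊ hPD,
    Finset.mul_sum, ← Finset.sum_sub_distrib]
  refine Finset.sum_congr rfl fun d _ => ?_
  -- identify the inner sums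
  have ha : ∑ n ∈ (Finset.Ioc x (2 * x)).filter (fun n => d ∣ n + 2), fa n =
      ∑ n ∈ (Finset.Ioc x (2 * x)).filter (fun n : ℕ => n.Prime ∧ d ∣ n + 2 ∧
        w ≤ ((n + 2).minFac : ℝ)), Real.log (n : ℝ) := by
    rw [hfa, Finset.sum_filter, Finset.sum_filter]
    refine Finset.sum_congr rfl fun n _ => ?_
    by_cases h1 : d ∣ n + 2
    · by_cases h2 : n.Prime ∧ w ≤ ((n + 2).minFac : ℝ)
      · rw [if_pos h1, if_pos h2, if_pos ⟨h2.1, h1, h2.2⟩]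
      · rw [if_pos h1, if_neg h2, if_neg (fun h => h2 ⟨h.1, h.2.2⟩)]
    · rw [if_neg h1, if_neg (fun h => h1 h.2.1)]
  have hb : ∑ n ∈ (Finset.Ioc x (2 * x)).filter (fun n => d ∣ n + 2), fb n =
      (#((Finset.Ioc x (2 * x)).filter (fun n : ℕ => (∀ p ∈ n.primeFactors, z ≤ (p : ℝ)) ∧
        w ≤ ((n + 2).minFac : ℝ) ∧ d ∣ n + 2)) : ℝ) := by
    rw [Finset.sum_filter, ← Finset.sum_boole]
    refine Finset.sum_congr rfl fun n _ => ?_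
    by_cases h1 : d ∣ n + 2
    · by_cases h2 : (∀ p ∈ n.primeFactors, z ≤ (p : ℝ)) ∧ w ≤ ((n + 2).minFac : ℝ)
      · rw [if_pos h1, show fb n = 1 from if_pos h2, if_pos ⟨h2.1, h2.2, h1⟩]
      · rw [if_pos h1, show fb n = 0 from if_neg h2, if_neg (fun h => h2 ⟨h.1, h.2.1⟩)]
    · rw [if_neg h1, if_neg (fun h => h1 h.2.2)]
  rw [ha, hb]; ring

/-- `|Σ_d μ(d) t_d| ≤ Σ_d |t_d|`. -/
theorem abs_sum_moebius_mul_le (S : Finset ℕ) (t : ℕ → ℝ) :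
    |∑ d ∈ S, (μ d : ℝ) * t d| ≤ ∑ d ∈ S, |t d| := by
  refine (Finset.abs_sum_le_sum_abs _ _).trans (Finset.sum_le_sum fun d _ => ?_)
  rw [abs_mul]
  have : |(μ d : ℝ)| ≤ 1 := by exact_mod_cast ArithmeticFunction.abs_moebius_le_one
  calc |(μ d : ℝ)| * |t d| ≤ 1 * |t d| := mul_le_mul_of_nonneg_right this (abs_nonneg _)
    _ = |t d| := one_mul _

/-- **The host remainder at one pair `(d, e)`.** For `x ≥ 2`, `d ≥ 1` with all prime factors `≥ y`,
`e ∣ P(w)` with `w ≤ y`: the remainder `r(d, e)` of `host_FL_le` satisfies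
`|r(d, e)| ≤ 2 E*(2x; de) + (ψ(2x) − ϑ(2x))`. -/
theorem host_rem_pair_le {x d e : ℕ} {y w : ℝ} (hx : 2 ≤ x) (hd : 0 < d)
    (hdr : ∀ p ∈ d.primeFactors, y ≤ (p : ℝ)) (hw2 : 2 < w) (hwy : w ≤ y) (he : e ∣ primesProdBelow w) :
    |(∑ n ∈ (Finset.Ioc x (2 * x)).filter (fun n : ℕ => n.Prime ∧ d ∣ n + 2 ∧ e ∣ n + 2),
        Real.log (n : ℝ)) - shiftedPrimesDensity 2 e * ((x : ℝ) / (Nat.totient d : ℝ))| ≤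
      2 * primeAPError ((2 * x : ℕ) : ℝ) (d * e) + (ψ ((2 * x : ℕ) : ℝ) - θ ((2 * x : ℕ) : ℝ)) := by
  have he0 : 0 < e := Nat.pos_of_dvd_of_pos he (Nat.pos_of_ne_zero (primesProdBelow_ne_zero w))
  have hΔ : 0 ≤ ψ ((2 * x : ℕ) : ℝ) - θ ((2 * x : ℕ) : ℝ) := by
    have := Chebyshev.theta_le_psi ((2 * x : ℕ) : ℝ); linarith
  have hPE : 0 ≤ primeAPError ((2 * x : ℕ) : ℝ) (d * e) := primeAPError_nonneg _ _
  -- `d` and `e` are coprime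
  have hcop : Nat.Coprime d e := by
    refine Nat.coprime_of_dvd fun p hp hpd hpe => ?_
    have hpw : (p : ℝ) < w := (dvd_primesProdBelow_iff hp w).1 (hpe.trans he)
    have hpy := hdr p (Nat.mem_primeFactors.2 ⟨hp, hpd, hd.ne'⟩)
    linarith
  by_cases h2 : 2 ∣ e
  · -- even `e`: the sum is empty and the density vanishes
    have hdens : shiftedPrimesDensity 2 e = 0 := by
      rw [shiftedPrimesDensity_apply, if_neg]
      rintro ⟨hc, -⟩
      exact (Nat.prime_two.coprime_iff_not_dvd.1 hc.symm) h2
    have hsum : ∑ n ∈ (Finset.Ioc x (2 * x)).filter (fun n : ℕ => n.Prime ∧ d ∣ n + 2 ∧ e ∣ n + 2),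
        Real.log (n : ℝ) = 0 := by
      refine Finset.sum_eq_zero fun n hn => ?_
      exfalso
      rw [Finset.mem_filter, Finset.mem_Ioc] at hn
      obtain ⟨⟨hn1, -⟩, hp, -, hen⟩ := hn
      have h2n : 2 ∣ n + 2 := h2.trans hen
      have h2n' : 2 ∣ n := by omega
      have := (Nat.prime_dvd_prime_iff_eq Nat.prime_two hp).1 h2n'
      omega
    rw [hsum, hdens, zero_mul, sub_zero, abs_zero]
    positivity
  · -- odd `e`: `r(d,e) = Σ_{prime, de ∣ n+2} log n − x/φ(de)`
    have hdodd : ¬ 2 ∣ d := by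
      intro h
      have := hdr 2 (Nat.mem_primeFactors.2 ⟨Nat.prime_two, h, hd.ne'⟩)
      push_cast at this
      linarith
    have hde : ¬ 2 ∣ d * e := by
      intro h; rcases (Nat.Prime.dvd_mul Nat.prime_two).1 h with h' | h'
      · exact hdodd h'
      · exact h2 h'
    have hcop2 : e.Coprime 2 := (Nat.prime_two.coprime_iff_not_dvd.2 h2).symm
    have hdens : shiftedPrimesDensity 2 e = ((Nat.totient e : ℕ) : ℝ)⁻¹ := by
      rw [shiftedPrimesDensity_apply, if_pos ⟨hcop2, he0.ne'⟩]
    have hφ : ((Nat.totient (d * e) : ℕ) : ℝ) = (Nat.totient d : ℝ) * (Nat.totient e : ℝ) := by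
      rw [Nat.totient_mul hcop]; push_cast; ring
    have hset : (Finset.Ioc x (2 * x)).filter (fun n : ℕ => n.Prime ∧ d ∣ n + 2 ∧ e ∣ n + 2) =
        (Finset.Ioc x (2 * x)).filter (fun n : ℕ => n.Prime ∧ d * e ∣ n + 2) := by
      refine Finset.filter_congr fun n _ => ?_
      constructor
      · rintro ⟨hp, h1, h2'⟩; exact ⟨hp, hcop.mul_dvd_of_dvd_of_dvd h1 h2'⟩
      · rintro ⟨hp, h⟩; exact ⟨hp, (dvd_mul_right d e).trans h, (dvd_mul_left e d).trans h⟩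
    have e1 : shiftedPrimesDensity 2 e * ((x : ℝ) / (Nat.totient d : ℝ)) =
        (x : ℝ) / (Nat.totient (d * e) : ℝ) := by
      rw [hdens, hφ]
      field_simp
    rw [hset, e1]
    have h := host_rem_le (q := d * e) (by positivity) hde (x := x) (by omega)
    linarith [h]

/-- **Re-indexing the pairs `(d, e)` by `q = de`.** If every `d ∈ S` has all prime factors `≥ y`,
every `e ∈ T` divides `P(w)` with `w ≤ y`, `de ≤ Q` on `S × T`, and `F ≥ 0`, then
`Σ_{d ∈ S} Σ_{e ∈ T} F(de) ≤ Σ_{q ≤ Q} F(q)`. -/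
theorem sum_pairs_le_sum_Icc (S T : Finset ℕ) {y w : ℝ} (Q : ℕ) (F : ℕ → ℝ)
    (hS : ∀ d ∈ S, 0 < d ∧ ∀ p ∈ d.primeFactors, y ≤ (p : ℝ))
    (hT : ∀ e ∈ T, e ∣ primesProdBelow w) (hwy : w ≤ y)
    (hQ : ∀ d ∈ S, ∀ e ∈ T, d * e ≤ Q) (hF : ∀ q, 0 ≤ F q) :
    ∑ d ∈ S, ∑ e ∈ T, F (d * e) ≤ ∑ q ∈ Finset.Icc 1 Q, F q := by
  rw [← Finset.sum_product']
  refine sum_le_sum_of_injOn_nonneg (S ×ˢ T) (Finset.Icc 1 Q) (fun de => F (de.1 * de.2)) F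
    (fun de => de.1 * de.2) ?_ ?_ (fun _ _ => le_rfl) (fun q _ => hF q)
  · intro de hde
    rw [Finset.mem_product] at hde
    have h1 := hS de.1 hde.1
    have he0 : 0 < de.2 :=
      Nat.pos_of_dvd_of_pos (hT de.2 hde.2) (Nat.pos_of_ne_zero (primesProdBelow_ne_zero w))
    rw [Finset.mem_Icc]
    exact ⟨Nat.one_le_iff_ne_zero.2 (Nat.mul_ne_zero h1.1.ne' he0.ne'), hQ de.1 hde.1 de.2 hde.2⟩
  · -- injectivity: the `y`-rough part and the `P(w)`-part determine each other
    rintro ⟨d₁, e₁⟩ h₁ ⟨d₂, e₂⟩ h₂ heq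
    simp only [Finset.coe_product, Set.mem_prod, Finset.mem_coe] at h₁ h₂
    simp only at heq
    have cop : ∀ d ∈ S, ∀ e ∈ T, Nat.Coprime d e := by
      intro d hd e he
      refine Nat.coprime_of_dvd fun p hp hpd hpe => ?_
      have hpw : (p : ℝ) < w := (dvd_primesProdBelow_iff hp w).1 (hpe.trans (hT e he))
      have hpy := (hS d hd).2 p (Nat.mem_primeFactors.2 ⟨hp, hpd, (hS d hd).1.ne'⟩)
      linarith
    have hd12 : d₁ ∣ d₂ := by
      have : d₁ ∣ d₂ * e₂ := ⟨e₁, by rw [← heq]⟩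
      exact (cop d₁ h₁.1 e₂ h₂.2).dvd_of_dvd_mul_right this
    have hd21 : d₂ ∣ d₁ := by
      have : d₂ ∣ d₁ * e₁ := ⟨e₂, by rw [heq]⟩
      exact (cop d₂ h₂.1 e₁ h₁.2).dvd_of_dvd_mul_right this
    have hd : d₁ = d₂ := Nat.dvd_antisymm hd12 hd21
    subst hd
    have he : e₁ = e₂ := Nat.eq_of_mul_eq_mul_left (hS d₁ h₁.1).1 heq
    rw [he]

end Summit.Parity.GeneralizedHardyLittlewood.Theorems.ParityLeakOneFifth
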